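/-
Copyright (c) 2026. All rights reserved.
Released under Apache 2.0 license as described in the file LICENSE.
Authors: abc-iut cell, statement-typer seat abc-iut-L4-t3 (wave 1).
-/
import Literature.AnabelianGeometry.AbsoluteAnabelian.LogFrobeniusContact
import Literature.AnabelianGeometry.AbsoluteAnabelian.LogFrobeniusPanalocalization
import Literature.AnabelianGeometry.AbsoluteAnabelian.LogFrobeniusTelecoreProofs
import HarnessLib

/-!
# [AbsTopIII] Corollary 5.5 (v), last sentence and (vi), telecore clause: extensions to the telecore diagram `D_{An•}`

S. Mochizuki, *Topics in absolute anabelian geometry III: global reconstruction algorithms*,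
J. Math. Sci. Univ. Tokyo 22 (2015) 939–1156 [MochizukiAbsTopIII2015]; locators read on the page: Cor 5.5 (v), last
sentence, p. 132: "these self-equivalences also extend naturally [cf. the technique of extension applied in Definition 3.5,
(vi)] to the diagram of categories [cf. Definition 3.5, (iv), (a)] that constitutes the telecore of (ii), in a fashion that
is compatible with both the family of homotopies that constitutes this telecore structure [cf. Definition 3.5, (iv), (b)]
and the contact structure `ℋ_{An•}` of (ii)"; Cor 5.5 (vi) p. 132: "There is a natural panalocalization morphism of diagrams
of categories `D⊚ → D✠` … that … is compatible with the cores of (i), the telecore and contact structures of (ii), the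
observables of (iii), and the `ℤ`-actions of (v)" (proof p. 133: "immediate from the definitions and constructions").

Both clauses were left TODO(general form) by this seat's `LogFrobeniusRigidity.lean` (`Cor55ShiftAction`: the shifts of
`D•⊢` only) and `LogFrobeniusPanalocalization.lean` (`Panalocalization.CompatibleWithTelecoreData`: at the level of the
generating data `φ_{An•}`, `η_{An•}` only — "NOT typed: the telecore-diagram extension"). Over `LogFrobeniusContact.lean`
(the telecore `𝔗_{An•}` with its contact structure `ℋ_{An•}` PINNED by generators, `IsAnContactGenerated`) they are typed
here in the LITERAL Def 3.5 (v) form, following abc-iut-L4-t5's typing of the same sentences of Cor 3.6 (v)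
(`AbsTopIII/FrobeniusPictureMLFCompatibility.lean`, `ShiftTelecoreCompatStmt`): the extended self-equivalences / the
extended 1-morphism of the telecore diagrams are EXISTENTIALLY quantified, pinned to the shifts `L.shiftApp` / to the
panalocalization's functors `Panalocalization.app` on the vertices of `D•_{≤5}` and to the identity / `panAn` at the core
vertex `An•[𝒳]`, and required to be compatible (abc-iut-L4-t2's `OneMorphism.CompatibleWith`: bijection of boundary sets,
homotopies commuting with the 2-cells) with the telecore families `𝔍` and the contact structures `ℋ_{An•}`:
`Cor55ShiftActionTelecore` (v), `Cor55PanalocalizationTelecore` (vi). Degenerate boundary (disclosure): both statements are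
FALSE as typed when `V(F_mod) = ∅` — no core structure with core vertex `An•[𝒳]` exists on `D•_{≤5}` (abc-iut-L4-t15's
`not_cor55Telecore_of_isEmpty`): `not_cor55ShiftActionTelecore_of_isEmpty`, `not_cor55PanalocalizationTelecore_of_isEmpty`;
they are ASSUMPTIONS on `L` / on `(L₁, L₂, P)` asserted by the text for the genuine theaters (`V(F_mod) ≠ ∅`); refereed
pre-IUT material; nothing here bears on [IUTchIII] Cor. 3.12; typed ≠ discharged.
-/

set_option autoImplicit false

universe u

open CategoryTheory Quiver

namespace Literature.AnabelianGeometry.AbsoluteAnabelian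

namespace LogFrobeniusSetting

variable {Vmod : Type u} {isArc : Vmod → Bool} (L : LogFrobeniusSetting Vmod isArc)

/-- the shift `n ↦ n + k` preserves `D•_{≤5}`. [cite: MochizukiAbsTopIII2015, Cor 5.5 (v) p. 132] -/
theorem inFive_shift (k : ℤ) {x : DVertex Vmod isArc} (h : InFive (isArc := isArc) x) :
    InFive (isArc := isArc) (x.shift k) := by
  cases x <;> exact h

/-- A self-equivalence `Ψ` of the telecore diagram `D_{An•}` EXTENDS THE SHIFT by `k` (the "technique of extension" of
Def 3.5 (vi): the same map on the vertices and arrows of `D•_{≤5}` and the same — identity — functors there as the shift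
`L.shiftOneMorphism k` of `D•⊢`, the identity at the core vertex `An•[𝒳]`).
[cite: MochizukiAbsTopIII2015, Cor 5.5 (v) p. 132] -/
def ExtendsShift {J : DSub (InFive (isArc := isArc)) → Type u}
    {tel : ∀ {a : DSub (InFive (isArc := isArc))}, J a → (L.An ⥤ a.1.category L)} (k : ℤ)
    (Ψ : (L.anTelecoreDiagram J tel).SelfEquivalence) : Prop :=
  (∀ a : DSub (InFive (isArc := isArc)),
      Ψ.graphMap.obj ((anTelecoreShape J).base a) = (anTelecoreShape J).base ⟨a.1.shift k, inFive_shift k a.2⟩ ∧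
        HEq (Ψ.hom.app ((anTelecoreShape J).base a)) (L.shiftApp k a.1)) ∧
    (∀ {a b : DSub (InFive (isArc := isArc))} (e : DEdge isArc a.1 b.1),
      HEq (Ψ.graphMap.map (show (anTelecoreShape J).base a ⟶ (anTelecoreShape J).base b from e))
        (DVertex.shiftHom k (show a.1 ⟶ b.1 from e))) ∧
    Ψ.graphMap.obj (anTelecoreShape J).obs = (anTelecoreShape J).obs ∧
      HEq (Ψ.hom.app (anTelecoreShape J).obs) (𝟭 L.An)

/-- **Cor 5.5 (v), last sentence** (assumption on `L`): for the telecore `𝔗_{An•}` of (ii) — over a core of (i) with core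
vertex `An•[𝒳]`, telecore edges `φ_⋏ = φ_{An•}` — with its contact structure `ℋ_{An•}` generated by the printed
homotopies (`IsAnContactGenerated`), the shifts of Cor 5.5 (v) "extend naturally … to the diagram of categories … that
constitutes the telecore of (ii)" — for every `k` a self-equivalence `Ψ_k` of `D_{An•}` extending the shift by `k`
(`ExtendsShift`) — "in a fashion that is compatible with both the family of homotopies that constitutes this telecore
structure and the contact structure `ℋ_{An•}`" (Def 3.5 (v)-compatibility, `OneMorphism.CompatibleWith`, with `𝔍` and
with `ℋ_{An•}`). [cite: MochizukiAbsTopIII2015, Cor 5.5 (v) p. 132] -/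
def Cor55ShiftActionTelecore : Prop :=
  ∃ (H : ((L.subdiagram (InFive (isArc := isArc))).extend (L.obsExt InFive .an)).HomotopyFamily)
    (hH : ∀ ⦃a b : (obsShape (InFive (isArc := isArc)) DVertex.an).Vertex⦄ ⦃p q : Path a b⦄,
      H.E p q → b = (obsShape (InFive (isArc := isArc)) DVertex.an).obs)
    (hc : (DiagramOfCategories.Observable.mk _ (fun _ => (inferInstance : IsEmpty PEmpty.{u + 1})) _ H hH).IsCore)
    (T : DiagramOfCategories.Telecore _ _ hc)
    (_ : T.J = (fun a => TelecoreIdx a.1))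
    (_ : HEq (fun (a : DSub (InFive (isArc := isArc))) (j : T.J a) => T.telMap j)
      (fun (a : DSub (InFive (isArc := isArc))) (j : TelecoreIdx a.1) => L.telecoreFun a.1 j))
    (Hc : (L.anTelecoreDiagram T.J T.telMap).HomotopyFamily)
    (Ψ : ℤ → (L.anTelecoreDiagram T.J T.telMap).SelfEquivalence),
    DiagramOfCategories.Telecore.IsContactStructure _ T Hc ∧ L.IsAnContactGenerated T Hc ∧
      (∀ k : ℤ, L.ExtendsShift k (Ψ k)) ∧
      ∀ k : ℤ, Nonempty ((Ψ k).hom.CompatibleWith T.Jfam T.Jfam) ∧ Nonempty ((Ψ k).hom.CompatibleWith Hc Hc)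

/-- **`V(F_mod) ≠ ∅` is necessary** for `Cor55ShiftActionTelecore` as typed: its core clause for `An•[𝒳]` fails when
`V(F_mod) = ∅` (through the unpinned Cor 5.5 (ii), abc-iut-L4-t15's `not_cor55Telecore_of_isEmpty`).
[cite: MochizukiAbsTopIII2015, Cor 5.5 (v) p. 132] -/
theorem not_cor55ShiftActionTelecore_of_isEmpty [IsEmpty Vmod] : ¬ L.Cor55ShiftActionTelecore := by
  rintro ⟨H, hH, hc, T, hJ, htel, Hc, -, hHc, -⟩
  exact L.not_cor55Telecore_of_isEmpty ⟨H, hH, hc, T, hJ, htel, Hc, hHc⟩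

end LogFrobeniusSetting

/-! ## Cor 5.5 (vi): the panalocalization morphism on the telecore diagrams -/

namespace Panalocalization

variable {Vmod : Type u} {isArc : Vmod → Bool} {L₁ L₂ : LogFrobeniusSetting Vmod isArc} (P : Panalocalization L₁ L₂)

/-- A 1-morphism `Ψ : D⊚_{An•} → D✠_{An•}` of the telecore diagrams, over a morphism `G` of their oriented graphs, EXTENDS
THE PANALOCALIZATION `P`: `G` is "the evident isomorphism of oriented graphs `Γ⃗⊚_D ⥲ Γ⃗✠_D`" (the identity on the common
shape: the vertices and arrows of `D•_{≤5}`, the core vertex `An•[𝒳]`, the observation edges `κ_{An•}`; the telecore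
edges `φ_⋏`, one per `⋏ ∈ L ∪ {□}` on either side, correspond under `G` automatically), and the functors of `Ψ` at the
vertices of `D•_{≤5}` resp. at `An•[𝒳]` are those of `P` (`Panalocalization.app`) resp. `panAn`.
[cite: MochizukiAbsTopIII2015, Cor 5.5 (vi) p. 132] -/
def ExtendsToTelecore {J₁ J₂ : DSub (LogFrobeniusSetting.InFive (isArc := isArc)) → Type u}
    {tel₁ : ∀ {a : DSub (LogFrobeniusSetting.InFive (isArc := isArc))}, J₁ a → (L₁.An ⥤ a.1.category L₁)}
    {tel₂ : ∀ {a : DSub (LogFrobeniusSetting.InFive (isArc := isArc))}, J₂ a → (L₂.An ⥤ a.1.category L₂)}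
    (G : (LogFrobeniusSetting.anTelecoreShape (isArc := isArc) J₁).Vertex ⥤q
      (LogFrobeniusSetting.anTelecoreShape (isArc := isArc) J₂).Vertex)
    (Ψ : DiagramOfCategories.OneMorphism G (L₁.anTelecoreDiagram J₁ tel₁) (L₂.anTelecoreDiagram J₂ tel₂)) : Prop :=
  (∀ a : DSub (LogFrobeniusSetting.InFive (isArc := isArc)),
      G.obj ((LogFrobeniusSetting.anTelecoreShape J₁).base a) = (LogFrobeniusSetting.anTelecoreShape J₂).base a ∧
        HEq (Ψ.app ((LogFrobeniusSetting.anTelecoreShape J₁).base a)) (P.app a.1)) ∧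
    (∀ {a b : DSub (LogFrobeniusSetting.InFive (isArc := isArc))} (e : DEdge isArc a.1 b.1),
      HEq (G.map (show (LogFrobeniusSetting.anTelecoreShape (isArc := isArc) J₁).base a ⟶
        (LogFrobeniusSetting.anTelecoreShape J₁).base b from e)) e) ∧
    (∀ {a : DSub (LogFrobeniusSetting.InFive (isArc := isArc))} (i : DEdge isArc a.1 DVertex.an),
      HEq (G.map (show (LogFrobeniusSetting.anTelecoreShape (isArc := isArc) J₁).base a ⟶
        (LogFrobeniusSetting.anTelecoreShape J₁).obs from i)) i) ∧
    G.obj (LogFrobeniusSetting.anTelecoreShape J₁).obs = (LogFrobeniusSetting.anTelecoreShape J₂).obs ∧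
      HEq (Ψ.app (LogFrobeniusSetting.anTelecoreShape J₁).obs) P.panAn

/-- **Cor 5.5 (vi), telecore clause** (assumption on `(L₁, L₂, P)`, `• = ⊚` resp. `✠`): the panalocalization morphism
`D⊚ → D✠` "is compatible with … the telecore and contact structures of (ii)" in the literal sense of Def 3.5 (v): for the
telecores `𝔗_{An⊚}`, `𝔗_{An✠}` of (ii) (over cores with core vertex `An•[𝒳]`, telecore edges `φ_⋏ = φ_{An•}`) with their
contact structures `ℋ_{An⊚}`, `ℋ_{An✠}` generated by the printed homotopies (`IsAnContactGenerated`), there is a 1-morphism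
of the telecore diagrams `Ψ : D⊚_{An•} → D✠_{An•}` extending `P` (`ExtendsToTelecore`) that is compatible
(`OneMorphism.CompatibleWith`) with the telecore families `𝔍⊚`, `𝔍✠` and with the contact structures `ℋ_{An⊚}`, `ℋ_{An✠}`.
(The generating-data form — `η_{An⊚}` is carried to `η_{An✠}` under the comparison 2-cell — is
`CompatibleWithTelecoreData`; the cores / observables / `ℤ`-actions clauses are `CompatibleWithFamilies` /
`CompatibleWithShifts`; all in `LogFrobeniusPanalocalization.lean`.) [cite: MochizukiAbsTopIII2015, Cor 5.5 (vi) p. 132] -/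
def Cor55PanalocalizationTelecore : Prop :=
  ∃ (H₁ : ((L₁.subdiagram (LogFrobeniusSetting.InFive (isArc := isArc))).extend
      (L₁.obsExt LogFrobeniusSetting.InFive .an)).HomotopyFamily)
    (hH₁ : ∀ ⦃a b : (LogFrobeniusSetting.obsShape (LogFrobeniusSetting.InFive (isArc := isArc)) DVertex.an).Vertex⦄
      ⦃p q : Path a b⦄, H₁.E p q → b = (LogFrobeniusSetting.obsShape (LogFrobeniusSetting.InFive (isArc := isArc))
        DVertex.an).obs)
    (hc₁ : (DiagramOfCategories.Observable.mk _ (fun _ => (inferInstance : IsEmpty PEmpty.{u + 1})) _ H₁ hH₁).IsCore)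
    (T₁ : DiagramOfCategories.Telecore _ _ hc₁)
    (_ : T₁.J = (fun a => LogFrobeniusSetting.TelecoreIdx a.1))
    (_ : HEq (fun (a : DSub (LogFrobeniusSetting.InFive (isArc := isArc))) (j : T₁.J a) => T₁.telMap j)
      (fun (a : DSub (LogFrobeniusSetting.InFive (isArc := isArc))) (j : LogFrobeniusSetting.TelecoreIdx a.1) =>
        L₁.telecoreFun a.1 j))
    (Hc₁ : (L₁.anTelecoreDiagram T₁.J T₁.telMap).HomotopyFamily)
    (H₂ : ((L₂.subdiagram (LogFrobeniusSetting.InFive (isArc := isArc))).extend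
      (L₂.obsExt LogFrobeniusSetting.InFive .an)).HomotopyFamily)
    (hH₂ : ∀ ⦃a b : (LogFrobeniusSetting.obsShape (LogFrobeniusSetting.InFive (isArc := isArc)) DVertex.an).Vertex⦄
      ⦃p q : Path a b⦄, H₂.E p q → b = (LogFrobeniusSetting.obsShape (LogFrobeniusSetting.InFive (isArc := isArc))
        DVertex.an).obs)
    (hc₂ : (DiagramOfCategories.Observable.mk _ (fun _ => (inferInstance : IsEmpty PEmpty.{u + 1})) _ H₂ hH₂).IsCore)
    (T₂ : DiagramOfCategories.Telecore _ _ hc₂)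
    (_ : T₂.J = (fun a => LogFrobeniusSetting.TelecoreIdx a.1))
    (_ : HEq (fun (a : DSub (LogFrobeniusSetting.InFive (isArc := isArc))) (j : T₂.J a) => T₂.telMap j)
      (fun (a : DSub (LogFrobeniusSetting.InFive (isArc := isArc))) (j : LogFrobeniusSetting.TelecoreIdx a.1) =>
        L₂.telecoreFun a.1 j))
    (Hc₂ : (L₂.anTelecoreDiagram T₂.J T₂.telMap).HomotopyFamily)
    (G : (LogFrobeniusSetting.anTelecoreShape (isArc := isArc) T₁.J).Vertex ⥤q
      (LogFrobeniusSetting.anTelecoreShape (isArc := isArc) T₂.J).Vertex)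
    (Ψ : DiagramOfCategories.OneMorphism G (L₁.anTelecoreDiagram T₁.J T₁.telMap) (L₂.anTelecoreDiagram T₂.J T₂.telMap)),
    DiagramOfCategories.Telecore.IsContactStructure _ T₁ Hc₁ ∧ L₁.IsAnContactGenerated T₁ Hc₁ ∧
      DiagramOfCategories.Telecore.IsContactStructure _ T₂ Hc₂ ∧ L₂.IsAnContactGenerated T₂ Hc₂ ∧
      P.ExtendsToTelecore G Ψ ∧
      Nonempty (Ψ.CompatibleWith T₁.Jfam T₂.Jfam) ∧ Nonempty (Ψ.CompatibleWith Hc₁ Hc₂)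

/-- **`V(F_mod) ≠ ∅` is necessary** for `Cor55PanalocalizationTelecore` as typed (the core clause for `An⊚[𝒳]` fails when
`V(F_mod) = ∅`: abc-iut-L4-t15's `not_cor55Telecore_of_isEmpty`). [cite: MochizukiAbsTopIII2015, Cor 5.5 (vi) p. 132] -/
theorem not_cor55PanalocalizationTelecore_of_isEmpty [IsEmpty Vmod] : ¬ P.Cor55PanalocalizationTelecore := by
  rintro ⟨H₁, hH₁, hc₁, T₁, hJ₁, htel₁, Hc₁, _, _, _, _, _, _, _, _, _, hHc₁, -⟩
  exact L₁.not_cor55Telecore_of_isEmpty ⟨H₁, hH₁, hc₁, T₁, hJ₁, htel₁, Hc₁, hHc₁⟩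

end Panalocalization

end Literature.AnabelianGeometry.AbsoluteAnabelian
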